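import Summits.ValiantsHypothesis.ValiantsHypothesis.Theorems.NcAutomatonIntersection
import HarnessLib

/-!
# The central structure of a noncommutative circuit (Hrubeš–Wigderson–Yehudayoff, Prop. A.2)

Workshop file for the node `CommutativityDial` (decomp-valiant lens 6; road K5a′, stage 1 of 3 towards
the named fact `HWY10_thm_1_7`). DEGREE API on the automaton instrument of `NcAutomatonIntersection`:
the COUNTING automaton `cnt d` on `Fin (d+2)` makes `degPart d e := dfaProj (cnt d) 0 e` the degree-`e`
component (`e ≤ d`); §1 linear induction over words and parts of parts, §2 the calculus of components
(shift, `degPart_mul`, homogeneous products, letters, scalars). §3 is the **STRUCTURE THEOREM in span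
form** (`central_structure`, every commutative semiring): a fan-in-two circuit value homogeneous of
degree `d ≥ 4` lies in the `R`-span of the CENTRAL products `h · g · h̄` whose BODIES `g` are the
window-degree (`d ≤ 3·deg g < 2d`) components of the circuit's OWN gate values (`≤ size` per degree),
`h, h̄` homogeneous — HWY's Proposition A.2 read on the raw circuit, no homogenisation pass, no removal
of zero gates. HONEST FRAMING: theorem in print (Hrubeš–Wigderson–Yehudayoff, J. AMS 24 (2011),
Prop. A.2), new in the kernel; only the bookkeeping is sharper; `VP ≠ VNP` untouched.
-/

noncomputable section

namespace Summit.ValiantsHypothesis.ValiantsHypothesis.Theorems.NcCentralWidth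

open Literature.Computability.AlgebraicComplexity
open Literature.Computability.AlgebraicComplexity.ArithCircuit
open Summit.ValiantsHypothesis.ValiantsHypothesis.Theorems.NcAutomatonIntersection

universe u v w

/-! ## §1 Words: linear induction on the free algebra, parts of words, parts of parts -/

section Words

variable {R : Type u} [CommSemiring R] {σ : Type v} {Q : Type w} [DecidableEq Q] (δ : Q → σ → Q)

omit [DecidableEq Q] in
/-- Monomials pull back to scaled words: `E⁻¹ (r·[w]) = r • w`. [cite: HrubesWigdersonYehudayoff2010, §2] -/
theorem equiv_symm_single (r : R) (w : List σ) :
    FreeAlgebra.equivMonoidAlgebraFreeMonoid.symm (MonoidAlgebra.single (FreeMonoid.ofList w) r) =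
      r • (w.map (FreeAlgebra.ι R)).prod := by
  induction w generalizing r with
  | nil =>
    have h1 : MonoidAlgebra.single (FreeMonoid.ofList ([] : List σ)) r =
        r • (1 : MonoidAlgebra R (FreeMonoid σ)) := by
      rw [FreeMonoid.ofList_nil, MonoidAlgebra.one_def, MonoidAlgebra.smul_single', mul_one]
    rw [h1, map_smul, map_one, List.map_nil, List.prod_nil]
  | cons x w ih =>
    have hx : FreeAlgebra.equivMonoidAlgebraFreeMonoid (FreeAlgebra.ι R x) =
        MonoidAlgebra.single (FreeMonoid.of x) (1 : R) := by
      simp [FreeAlgebra.equivMonoidAlgebraFreeMonoid, MonoidAlgebra.of_apply]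
    have h2 : MonoidAlgebra.single (FreeMonoid.ofList (x :: w)) r =
        MonoidAlgebra.single (FreeMonoid.of x) (1 : R) * MonoidAlgebra.single (FreeMonoid.ofList w) r := by
      rw [MonoidAlgebra.single_mul_single, one_mul, FreeMonoid.ofList_cons]
    rw [h2, map_mul, ih, ← hx, AlgEquiv.symm_apply_apply, List.map_cons, List.prod_cons, mul_smul_comm]

omit [DecidableEq Q] in
/-- **Linear induction over words** (`0`, `+`, monomials `r • w`). [cite: HrubesWigdersonYehudayoff2010, §2] -/
theorem word_induction {P : FreeAlgebra R σ → Prop} (h0 : P 0)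
    (hadd : ∀ f g, P f → P g → P (f + g))
    (hw : ∀ (r : R) (w : List σ), P (r • (w.map (FreeAlgebra.ι R)).prod)) (f : FreeAlgebra R σ) :
    P f := by
  rw [← FreeAlgebra.equivMonoidAlgebraFreeMonoid.symm_apply_apply f]
  generalize FreeAlgebra.equivMonoidAlgebraFreeMonoid f = x
  induction x using MonoidAlgebra.induction_linear with
  | zero => rw [map_zero]; exact h0
  | add x y hx hy => rw [map_add]; exact hadd _ _ hx hy
  | single w r =>
    rw [← FreeMonoid.ofList_toList w, equiv_symm_single]
    exact hw r _

/-- The `(a,b)`-part of a word is the word or `0`. [cite: ArvindJoglekar2009, Thm 1] -/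
theorem dfaProj_word (a b : Q) (w : List σ) :
    dfaProj δ a b ((w.map (FreeAlgebra.ι R)).prod) = wordDfa (R := R) δ a b w := by
  have h := equiv_symm_single (σ := σ) (1 : R) w
  rw [one_smul] at h
  rw [dfaProj_apply, ← h, AlgEquiv.apply_symm_apply, dfaProjMA_single, one_smul,
    FreeMonoid.toList_ofList]

/-- **Parts of parts** (same start): `(f^{a,b})^{a,b'} = [b' = b]·f^{a,b}`. [cite: ArvindJoglekar2009, Thm 1] -/
theorem dfaProj_dfaProj (a b b' : Q) (f : FreeAlgebra R σ) :
    dfaProj δ a b' (dfaProj δ a b f) = if b' = b then dfaProj δ a b f else 0 := by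
  induction f using word_induction with
  | h0 => simp only [map_zero, ite_self]
  | hadd f g hf hg =>
    rw [map_add, map_add, hf, hg]
    split_ifs
    · rfl
    · rw [add_zero]
  | hw r w =>
    rw [map_smul, dfaProj_word, map_smul]
    by_cases h : w.foldl δ a = b
    · have hw' : wordDfa (R := R) δ a b w = (w.map (FreeAlgebra.ι R)).prod := if_pos h
      rw [hw', dfaProj_word]
      by_cases hb : b' = b
      · rw [if_pos hb, hb, hw']
      · rw [if_neg hb, show wordDfa (R := R) δ a b' w = 0 from if_neg (fun h' => hb (by rw [← h, ← h'])),
          smul_zero]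
    · have hw' : wordDfa (R := R) δ a b w = 0 := if_neg h
      rw [hw', map_zero, smul_zero]
      split_ifs <;> rfl

end Words

/-! ## §2 Degree components along the counting automaton -/

section Degree

variable {R : Type u} [CommSemiring R] {σ : Type v}

/-- The COUNTING automaton on `Fin (d+2)`: `q ↦ min (q+1) (d+1)`, sink `d+1` = «degree `> d`».
[cite: HrubesWigdersonYehudayoff2010, §A] -/
def cnt (d : ℕ) : Fin (d + 2) → σ → Fin (d + 2) := fun q _ => ⟨min (q.1 + 1) (d + 1), by omega⟩

/-- The degree-`e` COMPONENT `f_e` (`e ≤ d`; `e > d` names the tail): the `(0,e)`-part along `cnt d`. [cite: HrubesWigdersonYehudayoff2010, §A] -/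
def degPart (d e : ℕ) : FreeAlgebra R σ →ₗ[R] FreeAlgebra R σ :=
  dfaProj (cnt (σ := σ) d) ⟨0, by omega⟩ ⟨min e (d + 1), by omega⟩

/-- A word of length `ℓ` drives `q` to `min (q + ℓ) (d+1)`. [cite: HrubesWigdersonYehudayoff2010, §A] -/
theorem foldl_cnt (d : ℕ) (w : List σ) (q : Fin (d + 2)) :
    ((w.foldl (cnt d) q : Fin (d + 2)) : ℕ) = min (q.1 + w.length) (d + 1) := by
  induction w generalizing q with
  | nil =>
    have := q.2
    simp only [List.foldl_nil, List.length_nil, Nat.add_zero]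
    omega
  | cons x w ih =>
    rw [List.foldl_cons, ih, List.length_cons]
    simp only [cnt]
    omega

/-- Parts of a word along the counting automaton test its length. [cite: HrubesWigdersonYehudayoff2010, §A] -/
theorem wordDfa_cnt (d : ℕ) (q b : Fin (d + 2)) (w : List σ) :
    wordDfa (R := R) (cnt d) q b w =
      if min (q.1 + w.length) (d + 1) = b.1 then (w.map (FreeAlgebra.ι R)).prod else 0 := by
  unfold wordDfa
  by_cases h : min (q.1 + w.length) (d + 1) = b.1
  · rw [if_pos h, if_pos (Fin.ext ((foldl_cnt d w q).trans h))]
  · rw [if_neg h, if_neg (fun h' => h ((foldl_cnt d w q).symm.trans (congrArg Fin.val h')))]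

/-- **Shift**: the part from state `c` to `a ≤ d` is the component of degree `a − c`. [cite: HrubesWigdersonYehudayoff2010, §A] -/
theorem dfaProj_cnt_eq (d : ℕ) (c : Fin (d + 2)) {a : ℕ} (ha : a ≤ d) (f : FreeAlgebra R σ) :
    dfaProj (cnt d) c (⟨min a (d + 1), by omega⟩ : Fin (d + 2)) f =
      if c.1 ≤ a then degPart d (a - c.1) f else 0 := by
  have hc : c.1 < d + 2 := c.2
  induction f using word_induction with
  | h0 => simp only [map_zero, ite_self]
  | hadd f g hf hg =>
    rw [map_add, hf, hg]
    split_ifs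
    · rw [map_add]
    · rw [add_zero]
  | hw r w =>
    simp only [degPart, map_smul, dfaProj_word, wordDfa_cnt, Nat.zero_add]
    split_ifs <;> first | rfl | exact smul_zero _ | (exfalso; omega)

/-- **Products**: `(p·q)_a = Σ_{c ≤ a} p_c · q_{a−c}` (`a ≤ d`, summed over states). [cite: HrubesWigdersonYehudayoff2010, §A] -/
theorem degPart_mul (d : ℕ) {a : ℕ} (ha : a ≤ d) (p q : FreeAlgebra R σ) :
    degPart d a (p * q) =
      ∑ c : Fin (d + 2), degPart d c.1 p * (if c.1 ≤ a then degPart d (a - c.1) q else 0) := by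
  show dfaProj (cnt d) ⟨0, by omega⟩ ⟨min a (d + 1), by omega⟩ (p * q) = _
  rw [dfaProj_mul]
  refine Finset.sum_congr rfl fun c _ => ?_
  rw [dfaProj_cnt_eq d c ha]
  congr 1
  show _ = dfaProj (cnt d) ⟨0, by omega⟩ ⟨min c.1 (d + 1), by omega⟩ p
  congr 2
  exact Fin.ext (Nat.min_eq_left (by have := c.2; omega)).symm

/-- Components are idempotent: `(f_e)_e = f_e`. [cite: HrubesWigdersonYehudayoff2010, §A] -/
theorem degPart_idem (d e : ℕ) (f : FreeAlgebra R σ) : degPart d e (degPart d e f) = degPart d e f := by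
  unfold degPart
  rw [dfaProj_dfaProj, if_pos rfl]

/-- Components are orthogonal: `(f_e)_{e'} = 0`, `e' ≠ e ≤ d+1`. [cite: HrubesWigdersonYehudayoff2010, §A] -/
theorem degPart_degPart_of_ne {d e e' : ℕ} (h : e' ≠ e) (he : e ≤ d + 1) (he' : e' ≤ d + 1)
    (f : FreeAlgebra R σ) : degPart d e' (degPart d e f) = 0 := by
  unfold degPart
  rw [dfaProj_dfaProj, if_neg]
  intro h'
  have := congrArg Fin.val h'
  dsimp only at this
  omega

/-- **Homogeneous × homogeneous**: `(p_r · q_c)_{r+c} = p_r · q_c` (`r + c ≤ d`). [cite: HrubesWigdersonYehudayoff2010, §A] -/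
theorem degPart_mul_of_eq {d r c : ℕ} {p q : FreeAlgebra R σ} (hp : degPart d r p = p)
    (hq : degPart d c q = q) (hrc : r + c ≤ d) : degPart d (r + c) (p * q) = p * q := by
  rw [degPart_mul d hrc, Finset.sum_eq_single (⟨r, by omega⟩ : Fin (d + 2))]
  · dsimp only
    rw [if_pos (Nat.le_add_right r c), Nat.add_sub_cancel_left, hp, hq]
  · intro m _ hm
    have hm' : m.1 ≠ r := fun h => hm (Fin.ext h)
    rw [← hp, degPart_degPart_of_ne hm' (by omega) (by have := m.2; omega), zero_mul]
  · exact fun h => absurd (Finset.mem_univ _) h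

/-- Letters have no component of degree `2 ≤ a ≤ d`. [cite: HrubesWigdersonYehudayoff2010, §A] -/
theorem degPart_ι_eq_zero {d a : ℕ} (ha : 2 ≤ a) (had : a ≤ d) (x : σ) :
    degPart d a (FreeAlgebra.ι R x) = 0 := by
  unfold degPart
  rw [dfaProj_ι, if_neg]
  intro h
  have := congrArg Fin.val h
  simp only [cnt] at this
  omega

/-- Scalars have no component of degree `1 ≤ a ≤ d`. [cite: HrubesWigdersonYehudayoff2010, §A] -/
theorem degPart_algebraMap_eq_zero {d a : ℕ} (ha : 1 ≤ a) (had : a ≤ d) (c : R) :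
    degPart d a (algebraMap R (FreeAlgebra R σ) c) = 0 := by
  unfold degPart
  rw [dfaProj_algebraMap, if_neg]
  intro h
  have := congrArg Fin.val h
  dsimp only at this
  omega

/-- `1` is homogeneous of degree `0`. [cite: HrubesWigdersonYehudayoff2010, §A] -/
theorem degPart_zero_one (d : ℕ) : degPart d 0 (1 : FreeAlgebra R σ) = 1 := by
  unfold degPart
  rw [← map_one (algebraMap R (FreeAlgebra R σ)), dfaProj_algebraMap, if_pos (Fin.ext (by simp))]

end Degree

/-! ## §3 Central spans and the structure theorem -/

section Central

variable {R : Type u} [CommSemiring R] {σ : Type v}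

/-- The CENTRAL SPAN of total degree `a` over the body sets `B e`: the `R`-span of the products
`h · g · h̄` with `g ∈ B e` of window degree `d ≤ 3e < 2d`, `h = h_r` and `h̄ = h̄_{a−e−r}`
homogeneous (HWY's central polynomials, ungrouped). [cite: HrubesWigdersonYehudayoff2010, Prop. A.2] -/
def cenSpan (B : ℕ → Set (FreeAlgebra R σ)) (d a : ℕ) : Submodule R (FreeAlgebra R σ) :=
  Submodule.span R {x | ∃ (e r : ℕ) (g h hb : FreeAlgebra R σ), g ∈ B e ∧ d ≤ 3 * e ∧
    3 * e < 2 * d ∧ e + r ≤ a ∧ degPart d r h = h ∧ degPart d (a - e - r) hb = hb ∧ x = h * g * hb}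

/-- The BODIES drawn from a list of values: their degree-`e` components. [cite: HrubesWigdersonYehudayoff2010, Prop. A.2] -/
def bodies (vals : List (FreeAlgebra R σ)) (d : ℕ) : ℕ → Set (FreeAlgebra R σ) := fun e =>
  {g | ∃ p ∈ vals, g = degPart d e p}

/-- Central spans grow with the body sets. [cite: HrubesWigdersonYehudayoff2010, Prop. A.2] -/
theorem cenSpan_mono {B B' : ℕ → Set (FreeAlgebra R σ)} (hBB : ∀ e, B e ⊆ B' e) (d a : ℕ) :
    cenSpan B d a ≤ cenSpan B' d a :=
  Submodule.span_mono fun _ ⟨e, r, g, h, hb, hg, h1, h2, her, hh, hhb, hx⟩ =>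
    ⟨e, r, g, h, hb, hBB e hg, h1, h2, her, hh, hhb, hx⟩

/-- More values, more bodies. [cite: HrubesWigdersonYehudayoff2010, Prop. A.2] -/
theorem bodies_mono {vals vals' : List (FreeAlgebra R σ)} (h : vals ⊆ vals') (d e : ℕ) :
    bodies vals d e ⊆ bodies vals' d e :=
  fun _ ⟨p, hp, hg⟩ => ⟨p, h hp, hg⟩

/-- A window body is central (`h = h̄ = 1`). [cite: HrubesWigdersonYehudayoff2010, Prop. A.2] -/
theorem body_mem {B : ℕ → Set (FreeAlgebra R σ)} {d e : ℕ} {g : FreeAlgebra R σ} (hg : g ∈ B e)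
    (h1 : d ≤ 3 * e) (h2 : 3 * e < 2 * d) : g ∈ cenSpan B d e :=
  Submodule.subset_span ⟨e, 0, g, 1, 1, hg, h1, h2, le_rfl, degPart_zero_one d,
    by rw [show e - e - 0 = 0 by omega]; exact degPart_zero_one d, by rw [one_mul, mul_one]⟩

/-- Right multiplication by `q = q_c`: total degree `a ↦ a + c ≤ d`. [cite: HrubesWigdersonYehudayoff2010, Prop. A.2] -/
theorem mul_right_mem {B : ℕ → Set (FreeAlgebra R σ)} {d a c : ℕ} {x q : FreeAlgebra R σ}
    (hx : x ∈ cenSpan B d a) (hq : degPart d c q = q) (hac : a + c ≤ d) :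
    x * q ∈ cenSpan B d (a + c) := by
  have key : cenSpan B d a ≤ (cenSpan B d (a + c)).comap (LinearMap.mulRight R q) := by
    refine Submodule.span_le.mpr ?_
    rintro _ ⟨e, r, g, h, hb, hg, h1, h2, her, hh, hhb, rfl⟩
    rw [SetLike.mem_coe, Submodule.mem_comap, LinearMap.mulRight_apply]
    refine Submodule.subset_span ⟨e, r, g, h, hb * q, hg, h1, h2, by omega, hh, ?_, mul_assoc _ _ _⟩
    have := degPart_mul_of_eq hhb hq (by omega)
    rwa [show a - e - r + c = a + c - e - r by omega] at this
  simpa only [Submodule.mem_comap, LinearMap.mulRight_apply] using key hx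

/-- Left multiplication by `q = q_c`: total degree `a ↦ c + a ≤ d`. [cite: HrubesWigdersonYehudayoff2010, Prop. A.2] -/
theorem mul_left_mem {B : ℕ → Set (FreeAlgebra R σ)} {d a c : ℕ} {x q : FreeAlgebra R σ}
    (hx : x ∈ cenSpan B d a) (hq : degPart d c q = q) (hca : c + a ≤ d) :
    q * x ∈ cenSpan B d (c + a) := by
  have key : cenSpan B d a ≤ (cenSpan B d (c + a)).comap (LinearMap.mulLeft R q) := by
    refine Submodule.span_le.mpr ?_
    rintro _ ⟨e, r, g, h, hb, hg, h1, h2, her, hh, hhb, rfl⟩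
    rw [SetLike.mem_coe, Submodule.mem_comap, LinearMap.mulLeft_apply]
    refine Submodule.subset_span ⟨e, c + r, g, q * h, hb, hg, h1, h2, by omega,
      degPart_mul_of_eq hq hh (by omega), ?_, by rw [← mul_assoc, ← mul_assoc]⟩
    rwa [show c + a - e - (c + r) = a - e - r by omega]
  simpa only [Submodule.mem_comap, LinearMap.mulLeft_apply] using key hx

/-- Operands: letters/scalars vanish in degree `≥ d/3 ≥ 2`; gate references inherit. [cite: HrubesWigdersonYehudayoff2010, Prop. A.2] -/
theorem operand_mem {B : ℕ → Set (FreeAlgebra R σ)} {d : ℕ} (hd : 4 ≤ d)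
    (vals : List (FreeAlgebra R σ))
    (hvals : ∀ p ∈ vals, ∀ a, d ≤ 3 * a → a ≤ d → degPart d a p ∈ cenSpan B d a)
    (o : Operand R σ) {a : ℕ} (h3 : d ≤ 3 * a) (ha : a ≤ d) :
    degPart d a (o.ncEval vals) ∈ cenSpan B d a := by
  cases o with
  | var x =>
    rw [show (Operand.var x : Operand R σ).ncEval vals = FreeAlgebra.ι R x from rfl,
      degPart_ι_eq_zero (by omega) ha]
    exact zero_mem _
  | const c =>
    rw [show (Operand.const c : Operand R σ).ncEval vals = algebraMap R _ c from rfl,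
      degPart_algebraMap_eq_zero (by omega) ha]
    exact zero_mem _
  | gate i =>
    rw [ncEval_gate, List.getD_eq_getElem?_getD]
    by_cases hi : i < vals.length
    · rw [List.getElem?_eq_getElem hi, Option.getD_some]
      exact hvals _ (List.getElem_mem hi) a h3 ha
    · rw [List.getElem?_eq_none_iff.mpr (Nat.le_of_not_lt hi), Option.getD_none, map_zero]
      exact zero_mem _

/-- **One gate** (fan-in `≤ 2`): sums are linear; a window-degree product component IS a body; above
the window every term of `(u₁u₂)_a = Σ_b (u₁)_b (u₂)_{a−b}` has a factor of degree `≥ d/3`. [cite: HrubesWigdersonYehudayoff2010, Prop. A.2] -/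
theorem gate_mem {B : ℕ → Set (FreeAlgebra R σ)} {d : ℕ} (hd : 4 ≤ d)
    (vals : List (FreeAlgebra R σ))
    (hvals : ∀ p ∈ vals, ∀ a, d ≤ 3 * a → a ≤ d → degPart d a p ∈ cenSpan B d a)
    (g : Gate R σ) (hg : g.fanIn ≤ 2)
    (hbody : ∀ e, d ≤ 3 * e → 3 * e < 2 * d → degPart d e (g.ncEval vals) ∈ B e)
    {a : ℕ} (h3 : d ≤ 3 * a) (ha : a ≤ d) :
    degPart d a (g.ncEval vals) ∈ cenSpan B d a := by
  cases g with
  | sum args =>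
    rw [show Gate.ncEval vals (Gate.sum args) = (args.map fun ca => ca.1 • ca.2.ncEval vals).sum
      from rfl, map_list_sum, List.map_map]
    refine list_sum_mem fun x hx => ?_
    obtain ⟨⟨c, o⟩, -, rfl⟩ := List.mem_map.mp hx
    show degPart d a (c • o.ncEval vals) ∈ _
    rw [map_smul]
    exact Submodule.smul_mem _ c (operand_mem hd vals hvals o h3 ha)
  | prod args =>
    match args, hg, hbody with
    | [], _, _ =>
      rw [show Gate.ncEval vals (Gate.prod []) = (1 : FreeAlgebra R σ) by simp [Gate.ncEval],
        ← map_one (algebraMap R (FreeAlgebra R σ)), degPart_algebraMap_eq_zero (by omega) ha]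
      exact zero_mem _
    | [o], _, _ =>
      rw [show Gate.ncEval vals (Gate.prod [o]) = o.ncEval vals by simp [Gate.ncEval]]
      exact operand_mem hd vals hvals o h3 ha
    | [o, o'], _, hbody =>
      by_cases hwin : 3 * a < 2 * d
      · exact body_mem (hbody a h3 hwin) h3 hwin
      · rw [show Gate.ncEval vals (Gate.prod [o, o']) = o.ncEval vals * o'.ncEval vals by
          simp [Gate.ncEval], degPart_mul d ha]
        refine Submodule.sum_mem _ fun c _ => ?_
        split_ifs with hc
        · by_cases hb : d ≤ 3 * c.1
          · have := mul_right_mem (operand_mem hd vals hvals o hb (le_trans hc ha))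
              (degPart_idem d (a - c.1) (o'.ncEval vals)) (by omega)
            rwa [show c.1 + (a - c.1) = a by omega] at this
          · have := mul_left_mem (operand_mem hd vals hvals o' (a := a - c.1) (by omega) (by omega))
              (degPart_idem d c.1 (o.ncEval vals)) (by omega)
            rwa [show c.1 + (a - c.1) = a by omega] at this
        · rw [mul_zero]
          exact zero_mem _
    | _ :: _ :: _ :: _, hg, _ => simp [Gate.fanIn, Gate.args] at hg

/-- **All gates** (reverse induction on the program): every component of degree `≥ d/3` of every
gate value is central over the bodies of the program itself. [cite: HrubesWigdersonYehudayoff2010, Prop. A.2] -/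
theorem gates_mem {d : ℕ} (hd : 4 ≤ d) (gs : List (Gate R σ)) (h2 : ∀ g ∈ gs, g.fanIn ≤ 2) :
    ∀ p ∈ ncGateValues gs, ∀ a, d ≤ 3 * a → a ≤ d →
      degPart d a p ∈ cenSpan (bodies (ncGateValues gs) d) d a := by
  induction gs using List.reverseRecOn with
  | nil => intro p hp; simp [ncGateValues] at hp
  | append_singleton gs g ih =>
    have h2' : ∀ g' ∈ gs, g'.fanIn ≤ 2 := fun g' hg' => h2 g' (List.mem_append_left _ hg')
    have hg : g.fanIn ≤ 2 := h2 g (List.mem_append_right _ (List.mem_singleton_self g))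
    have hsub : ncGateValues gs ⊆ ncGateValues (gs ++ [g]) := by
      rw [ncGateValues_append_singleton]
      exact List.subset_append_left _ _
    have hmono : ∀ a, cenSpan (bodies (ncGateValues gs) d) d a ≤
        cenSpan (bodies (ncGateValues (gs ++ [g])) d) d a :=
      fun a => cenSpan_mono (fun e => bodies_mono hsub d e) d a
    intro p hp a h3 ha
    have hp' := hp
    rw [ncGateValues_append_singleton, List.mem_append, List.mem_singleton] at hp'
    rcases hp' with hp' | rfl
    · exact hmono a (ih h2' p hp' a h3 ha)
    · exact gate_mem hd (ncGateValues gs) (fun p hp a h3 ha => hmono a (ih h2' p hp a h3 ha)) g hg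
        (fun e _ _ => ⟨g.ncEval (ncGateValues gs), hp, rfl⟩) h3 ha

/-- **STRUCTURE THEOREM, SPAN FORM** (HWY Prop. A.2 on the raw circuit, every commutative semiring):
a fan-in-two circuit value homogeneous of degree `d ≥ 4` is an `R`-combination of central products
`h · g · h̄` — bodies `g` the window components (`d ≤ 3·deg g < 2d`) of its own gate values,
`h, h̄` homogeneous. [cite: HrubesWigdersonYehudayoff2010, Prop. A.2] -/
theorem central_structure (P : ArithCircuit R σ) (hP : P.IsFanInTwo) {d : ℕ} (hd : 4 ≤ d)
    (hf : degPart d d P.ncEval = P.ncEval) :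
    P.ncEval ∈ cenSpan (bodies (ncGateValues P.gates) d) d d := by
  rw [← hf]
  exact operand_mem hd (ncGateValues P.gates) (gates_mem hd P.gates hP) P.output (by omega) le_rfl

/-- **WIDTH, SIZE FORM**: size `s` for a homogeneous `f` of degree `d ≥ 4` makes `f` central over the
components of `≤ s` values (`≤ s` bodies per window degree). [cite: HrubesWigdersonYehudayoff2010, Prop. A.2] -/
theorem central_structure_of_size {f : FreeAlgebra R σ} {s d : ℕ} (hd : 4 ≤ d)
    (hf : degPart d d f = f) (h : HasNcCircuitSizeLE f s) :
    ∃ vals : List (FreeAlgebra R σ), vals.length ≤ s ∧ f ∈ cenSpan (bodies vals d) d d := by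
  obtain ⟨P, hP, rfl, hs⟩ := h
  refine ⟨ncGateValues P.gates, le_trans (le_of_eq ?_) hs, central_structure P hP hd hf⟩
  show (ncGateValues P.gates).length = P.gates.length
  simpa using (ncGateValues_append_getD P.gates []).1

end Central

end Summit.ValiantsHypothesis.ValiantsHypothesis.Theorems.NcCentralWidth

end
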